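import Mathlib
import Summits.NavierStokesRegularity.NavierStokesRegularity.Theorems.LerayQuarterDissipationFiniteDissipationLiouvilleCrossFlowDss
import Summits.NavierStokesRegularity.NavierStokesRegularity.Theorems.LerayQuarterDissipationFiniteDissipationLiouvillePersistenceSeq
import Summits.NavierStokesRegularity.NavierStokesRegularity.Theorems.LerayQuarterDissipationRecurrentReductionDScaling
import Literature.Analysis.FluidPDE.TypeIAncientMildRescale
import HarnessLib

/-!
# Crux `FiniteDissipationLiouville` (stmt-NavierStokesRegularity-22144): the cross-flow threshold ONE,
# file A — scaling bookkeeping and the continuity of the slice enstrophy along the enveloped class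

Theorems file of route `LerayQuarterDissipation` (lead prover g17; `--supports` the crux; sequel of
`…CrossFlowRigidity` / `…CrossFlowDss`). Navier–Stokes regularity is NOT proved by anything here; no
summit is.

The tree's law-free cross-flow threshold (pub-ns-dss, `…SimilarityEnstrophy.typeI_ancient_eq_zero_of_crossFlow_lt_one`):
`√(−t)‖ω × u‖ ≤ θ‖ω‖` everywhere with `θ < 1` forces an enveloped KNSS-gauge Type-I field to
vanish. This file settles the ENDPOINT `θ = 1` by a compactness (zoom-out) argument on top of the
monotone budget of `…CrossFlowDss` and the half-Beltrami rigidity of `…CrossFlowRigidity`: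

* `lerayOrbit_nsRescale`, `enstrophy_nsRescale` — the Leray orbit of the rescaling `V_c` is the
  shifted orbit, `U_{V_c}(s) = U_V(s − 2 log c)`, so `Z_{V_c}(s) = Z_V(s − 2 log c)`;
* `crossFlow_nsRescale`, `crossFlow_sim_of_phys` — the hypothesis is scale invariant / its
  similarity form;
* `tendsto_integral_sq_norm_curl_neg_one` — the enstrophy of the slice `t = −1` is continuous along
  sequences of the enveloped class with pointwise convergent gradients (dominated convergence under
  the class-uniform gauge bound `(‖x‖+1)²‖DV(−1,x)‖ ≤ K₁`);
* **`eq_zero_of_crossFlow_le_one`** — **a KNSS-gauge Type-I ancient mild field `V` with a Type-I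
  envelope (same constant) and `√(−t)‖curl V(t,x) × V(t,x)‖ ≤ ‖curl V(t,x)‖` for all `t < 0`, `x`
  vanishes identically.** Proof: `Z_V` is non-increasing (`…CrossFlowDss`) and bounded, so
  `Z_V(s) ↑ m` as `s → −∞`; the zoom-out sequence `V_{e^j}` has a KNSS limit `W`
  (`…Compactness.seqLimit`, gradients converge) in the same enveloped class with cross-flow `≤ 1`,
  and `Z_W ≡ m` (every slice of `W` is a limit of slices of `V` receding to `s → −∞`); a constant
  enstrophy is periodic, so `W ≡ 0` (`…CrossFlowDss.eq_zero_of_crossFlow_le_one_of_enstrophy_periodic`),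
  `m = 0`, `Z_V ≡ 0`, `V ≡ 0`;
* `not_singular_of_crossFlow_le_one`, `crossFlow_exceeds_of_singular` — regularity form and
  PORTRAIT: a singular member of the stratum with the envelope has, somewhere, velocity across the
  vorticity STRICTLY FASTER than the self-similar speed: `‖ω(t,x)‖ < √(−t)‖ω(t,x) × W(t,x)‖`.

HONEST FRAMING. An endpoint improvement (`θ < 1` ⇒ `θ ≤ 1`) of a law-free threshold row about a
HYPOTHETICAL object; no collar `1 + ε` is claimed (the compactness step here is qualitative).
Nothing is removed from the catalogued DSS wall beyond this sub-class; verdict of the line unchanged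
(FRONTIER). Nothing here bears on Navier–Stokes regularity or blow-up.

References: Koch–Nadirashvili–Seregin–Šverák, Acta Math. 203 (2009) §4 (compactness of the class);
Bradshaw–Tsai, Comm. PDE 42 (2017) §5; Chae–Wolf, arXiv:1610.09464 §4; folklore energy method.
-/

noncomputable section

set_option linter.dupNamespace false

namespace Summit.NavierStokesRegularity.NavierStokesRegularity.Theorems.FiniteDissipationLiouville.CrossFlow

open MeasureTheory Set Filter Topology Metric InnerProductSpace Function Real
open scoped RealInnerProductSpace ContDiff
open Literature.Analysis Literature.Analysis.FluidPDE
open Summit.NavierStokesRegularity.NavierStokesRegularity.Theorems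
open Summit.NavierStokesRegularity.NavierStokesRegularity.Theorems.GaussianGap
open Summit.NavierStokesRegularity.NavierStokesRegularity.Theorems.SimilarityEnstrophy
open Summit.NavierStokesRegularity.NavierStokesRegularity.Theorems.SmallDissipationGap
open Summit.NavierStokesRegularity.NavierStokesRegularity.Theorems.RecurrentReductionD
open Summit.NavierStokesRegularity.NavierStokesRegularity.Theorems.FiniteDissipationLiouville

variable {C : ℝ} {V : ℝ → EuclideanSpace ℝ (Fin 3) → EuclideanSpace ℝ (Fin 3)}

/-! ### Scaling bookkeeping -/

section Scaling

/-- **The Leray orbit of a rescaling is the shifted orbit**: `U_{V_c}(s) = U_V(s − 2 log c)`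
(`V_c(t,x) = c V(c²t, cx)`, `c > 0`). [cite: ChaeWolf2017RemovingDSS, §4] -/
theorem lerayOrbit_nsRescale {c : ℝ} (hc : 0 < c)
    (u : ℝ → EuclideanSpace ℝ (Fin 3) → EuclideanSpace ℝ (Fin 3)) (s : ℝ)
    (y : EuclideanSpace ℝ (Fin 3)) :
    lerayOrbit (nsRescale c u) s y = lerayOrbit u (s - 2 * Real.log c) y := by
  have h1 : Real.exp (-(s - 2 * Real.log c) / 2) = Real.exp (-s / 2) * c := by
    rw [show -(s - 2 * Real.log c) / 2 = -s / 2 + Real.log c by ring, Real.exp_add, Real.exp_log hc]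
  have h2 : Real.exp (-(s - 2 * Real.log c)) = Real.exp (-s) * c ^ 2 := by
    rw [show -(s - 2 * Real.log c) = -s + 2 * Real.log c by ring, Real.exp_add,
      show (2 : ℝ) * Real.log c = Real.log c + Real.log c by ring, Real.exp_add, Real.exp_log hc, sq]
  rw [lerayOrbit_apply, lerayOrbit_apply, nsRescale_apply, h1, h2,
    show c ^ 2 * -Real.exp (-s) = -(Real.exp (-s) * c ^ 2) by ring]
  simp only [smul_smul]
  congr 2
  rw [mul_comm]

/-- `Z_{V_c}(s) = Z_V(s − 2 log c)`. [folklore] -/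
theorem enstrophy_nsRescale {c : ℝ} (hc : 0 < c)
    (u : ℝ → EuclideanSpace ℝ (Fin 3) → EuclideanSpace ℝ (Fin 3)) (s : ℝ) :
    ∫ y, ‖lerayVorticity (nsRescale c u) s y‖ ^ 2 =
      ∫ y, ‖lerayVorticity u (s - 2 * Real.log c) y‖ ^ 2 := by
  have : lerayVorticity (nsRescale c u) s = lerayVorticity u (s - 2 * Real.log c) := by
    rw [lerayVorticity_apply, lerayVorticity_apply]
    congr 1
    funext y
    exact lerayOrbit_nsRescale hc u s y
  rw [this]

/-- The slice `s = 0` of the Leray orbit is the slice `t = −1`: `Z(0) = ∫‖curl V(−1)‖²`. [folklore] -/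
theorem enstrophy_zero_eq (u : ℝ → EuclideanSpace ℝ (Fin 3) → EuclideanSpace ℝ (Fin 3)) :
    ∫ y, ‖lerayVorticity u 0 y‖ ^ 2 = ∫ x, ‖curl (u (-1)) x‖ ^ 2 := by
  have : lerayOrbit u 0 = u (-1) := by
    funext y
    rw [lerayOrbit_apply]
    simp
  rw [lerayVorticity_apply, this]

/-- **The cross-flow hypothesis is scale invariant.** [folklore] -/
theorem crossFlow_nsRescale {c : ℝ} (hc : 0 < c)
    (hX : ∀ t < 0, ∀ x, Real.sqrt (-t) * ‖cross (curl (V t) x) (V t x)‖ ≤ ‖curl (V t) x‖) :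
    ∀ t < 0, ∀ x, Real.sqrt (-t) * ‖cross (curl (nsRescale c V t) x) (nsRescale c V t x)‖ ≤
      ‖curl (nsRescale c V t) x‖ := by
  intro t ht x
  have hct : c ^ 2 * t < 0 := mul_neg_of_pos_of_neg (by positivity) ht
  have key := hX (c ^ 2 * t) hct (c • x)
  have hsq : Real.sqrt (-(c ^ 2 * t)) = c * Real.sqrt (-t) := by
    rw [show -(c ^ 2 * t) = c ^ 2 * -t by ring, Real.sqrt_mul (sq_nonneg c), Real.sqrt_sq hc.le]
  rw [hsq] at key
  have hcurl : curl (nsRescale c V t) x = (c * c) • curl (V (c ^ 2 * t)) (c • x) := by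
    rw [curl_eq_curlCLM, fderiv_nsRescale, map_smul, ← curl_eq_curlCLM]
  rw [hcurl, nsRescale_apply, cross_smul_left, cross_smul_right, norm_smul, norm_smul, norm_smul,
    Real.norm_of_nonneg (by positivity : (0:ℝ) ≤ c * c), Real.norm_of_nonneg hc.le]
  have hcc : 0 ≤ c * c := by positivity
  calc Real.sqrt (-t) * (c * c * (c * ‖cross (curl (V (c ^ 2 * t)) (c • x)) (V (c ^ 2 * t) (c • x))‖))
      = c * c * (c * Real.sqrt (-t) * ‖cross (curl (V (c ^ 2 * t)) (c • x)) (V (c ^ 2 * t) (c • x))‖) := by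
        ring
    _ ≤ c * c * ‖curl (V (c ^ 2 * t)) (c • x)‖ := mul_le_mul_of_nonneg_left key hcc

/-- **The cross-flow hypothesis in similarity variables**: `√(−t)‖ω × V‖ ≤ ‖ω‖` for all `t < 0`,
`x` gives `‖Ω(s,y) × U(s,y)‖ ≤ ‖Ω(s,y)‖` for all `s, y`. [folklore] -/
theorem crossFlow_sim_of_phys
    (hX : ∀ t < 0, ∀ x, Real.sqrt (-t) * ‖cross (curl (V t) x) (V t x)‖ ≤ ‖curl (V t) x‖)
    (s : ℝ) (y : EuclideanSpace ℝ (Fin 3)) :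
    ‖cross (lerayVorticity V s y) (lerayOrbit V s y)‖ ≤ ‖lerayVorticity V s y‖ := by
  have hl0 : 0 < Real.exp (-s / 2) := Real.exp_pos _
  have hk0 : 0 < Real.exp (-s) := Real.exp_pos _
  have ht0 : -Real.exp (-s) < 0 := neg_neg_of_pos hk0
  have hU : lerayOrbit V s y = Real.exp (-s / 2) • V (-Real.exp (-s)) (Real.exp (-s / 2) • y) := by
    rw [lerayOrbit_apply]
  have hΩ : lerayVorticity V s y =
      Real.exp (-s) • curl (V (-Real.exp (-s))) (Real.exp (-s / 2) • y) := by
    rw [lerayVorticity_apply, curl_lerayOrbit]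
  have h := hX _ ht0 (Real.exp (-s / 2) • y)
  rw [neg_neg, sqrt_exp_neg] at h
  rw [hU, hΩ, cross_smul_left, cross_smul_right, norm_smul, norm_smul, norm_smul,
    Real.norm_of_nonneg hk0.le, Real.norm_of_nonneg hl0.le]
  calc Real.exp (-s) * (Real.exp (-s / 2) *
        ‖cross (curl (V (-Real.exp (-s))) (Real.exp (-s / 2) • y))
          (V (-Real.exp (-s)) (Real.exp (-s / 2) • y))‖)
      ≤ Real.exp (-s) * ‖curl (V (-Real.exp (-s))) (Real.exp (-s / 2) • y)‖ :=
        mul_le_mul_of_nonneg_left h hk0.le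

end Scaling

/-! ### Continuity of the slice enstrophy along the enveloped class -/

section Continuity

/-- **The enstrophy of the slice `t = −1` is continuous along the enveloped class.** For KNSS-gauge
Type-I fields `u j` with a Type-I envelope (all with the constant `C`) and a field `W` such that
`∇u_j(−1,x) → ∇W(−1,x)` for every `x`: `∫‖curl u_j(−1)‖² → ∫‖curl W(−1)‖²` (dominated convergence
under the class-uniform gauge bound `(‖x‖+1)²‖∇f(−1,x)‖ ≤ K₁`,
`IsTypeIAncientMild.exists_forall_pow_mul_norm_iteratedFDeriv_le_of_hasTypeIDecay`). [cite: KochNadirashviliSereginSverak2009, Prop. 4.1 (arXiv:0709.3599 p. 8)] -/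
theorem tendsto_integral_sq_norm_curl_neg_one
    {u : ℕ → ℝ → EuclideanSpace ℝ (Fin 3) → EuclideanSpace ℝ (Fin 3)}
    {W : ℝ → EuclideanSpace ℝ (Fin 3) → EuclideanSpace ℝ (Fin 3)}
    (hu : ∀ j, IsTypeIAncientMild C (u j)) (hdu : ∀ j, HasTypeIDecay C (u j))
    (hgr : ∀ x, Tendsto (fun j => fderiv ℝ (u j (-1)) x) atTop (𝓝 (fderiv ℝ (W (-1)) x))) :
    Tendsto (fun j => ∫ x, ‖curl (u j (-1)) x‖ ^ 2) atTop (𝓝 (∫ x, ‖curl (W (-1)) x‖ ^ 2)) := by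
  obtain ⟨K₁, hK₁0, hK₁⟩ :=
    IsTypeIAncientMild.exists_forall_pow_mul_norm_iteratedFDeriv_le_of_hasTypeIDecay 1 C
  obtain ⟨κ, hκ⟩ : ∃ κ : ℝ, κ = ‖curlCLM‖ := ⟨_, rfl⟩
  have hκ0 : 0 ≤ κ := by rw [hκ]; exact norm_nonneg curlCLM
  have h1 : (-1 : ℝ) < 0 := by norm_num
  -- the class-uniform pointwise bound at `t = -1`
  have hbd : ∀ (f : ℝ → EuclideanSpace ℝ (Fin 3) → EuclideanSpace ℝ (Fin 3)),
      IsTypeIAncientMild C f → HasTypeIDecay C f →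
      ∀ x, ‖curl (f (-1)) x‖ ^ 2 ≤ (κ * K₁) ^ 2 * (1 + ‖x‖) ^ (-(4 : ℝ)) := by
    intro f hf hdf x
    have h := hK₁ hf hdf (-1) h1 x
    rw [neg_neg, Real.sqrt_one, norm_iteratedFDeriv_one] at h
    have hpos : 0 < ‖x‖ + 1 := by positivity
    have hD : ‖fderiv ℝ (f (-1)) x‖ ≤ K₁ / (‖x‖ + 1) ^ (1 + 1) := by
      rw [le_div_iff₀ (by positivity), mul_comm]; exact h
    have hc : ‖curl (f (-1)) x‖ ≤ κ * (K₁ / (‖x‖ + 1) ^ (1 + 1)) := by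
      rw [hκ]
      exact (norm_curl_le (f (-1)) x).trans (mul_le_mul_of_nonneg_left hD (norm_nonneg curlCLM))
    have e : (1 + ‖x‖) ^ (-(4 : ℝ)) = ((1 + ‖x‖) ^ 4)⁻¹ := by
      rw [Real.rpow_neg (by positivity), show (4 : ℝ) = ((4 : ℕ) : ℝ) by norm_num, Real.rpow_natCast]
    calc ‖curl (f (-1)) x‖ ^ 2 ≤ (κ * (K₁ / (‖x‖ + 1) ^ (1 + 1))) ^ 2 :=
          pow_le_pow_left₀ (norm_nonneg _) hc 2
      _ = (κ * K₁) ^ 2 * (1 + ‖x‖) ^ (-(4 : ℝ)) := by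
          rw [e, add_comm ‖x‖ 1]
          field_simp
          ring
  have hcont : Continuous fun x : EuclideanSpace ℝ (Fin 3) => (κ * K₁) ^ 2 * (1 + ‖x‖) ^ (-(4 : ℝ)) :=
    continuous_const.mul ((continuous_const.add continuous_norm).rpow_const
      fun x => Or.inl (add_pos_of_pos_of_nonneg one_pos (norm_nonneg x)).ne')
  have imaj : Integrable fun x : EuclideanSpace ℝ (Fin 3) => (κ * K₁) ^ 2 * (1 + ‖x‖) ^ (-(4 : ℝ)) :=
    integrable_of_le_decay_four hcont (K := (κ * K₁) ^ 2) fun x => by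
      rw [Real.norm_of_nonneg (by positivity)]
  have hcurlc : ∀ (f : ℝ → EuclideanSpace ℝ (Fin 3) → EuclideanSpace ℝ (Fin 3)),
      IsTypeIAncientMild C f → Continuous fun x => ‖curl (f (-1)) x‖ ^ 2 := fun f hf =>
    (continuous_curl ((hf.contDiff_slice h1).of_le (by norm_cast))).norm.pow 2
  refine tendsto_integral_of_dominated_convergence (fun x => (κ * K₁) ^ 2 * (1 + ‖x‖) ^ (-(4 : ℝ)))
    (fun j => (hcurlc _ (hu j)).aestronglyMeasurable) imaj
    (fun j => Eventually.of_forall fun x => ?_) (Eventually.of_forall fun x => ?_)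
  · rw [Real.norm_of_nonneg (sq_nonneg _)]
    exact hbd _ (hu j) (hdu j) x
  · have hc : Tendsto (fun j => curl (u j (-1)) x) atTop (𝓝 (curl (W (-1)) x)) := by
      simp only [curl_eq_curlCLM]
      exact (curlCLM.continuous.tendsto _).comp (hgr x)
    exact (hc.norm).pow 2

end Continuity

end Summit.NavierStokesRegularity.NavierStokesRegularity.Theorems.FiniteDissipationLiouville.CrossFlow

end
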